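import Literature.Probability.Percolation.SharpnessDCTProofs
import Summits.CriticalPhenomena.PercolationContinuityZ3.Theorems.PercNearOneGluingAdditiveGluingKnLemma3Mixed
import HarnessLib

/-! # Crux `PercNearOneGluing.AdditiveGluing` (stmt-CriticalPhenomena-4576), line `peel` — EXIT-RELAY CONE COMPARISON
# (peel cell, strategy (d) "generalise the certificates", part 2)

Support file (`--supports stmt-CriticalPhenomena-4576`); no definitions, no named facts.

`μ = prodBernoulli u` on the bond configurations of `Fin n`; relays `A ∋ b`; the designated relay `a₀` and another relay `a` with
`μ(a₀ ↔ b) ≤ μ(a ↔ b)` (an instance of `hmin`); a block `S` of vertices; a set `T₀ ∋ a` of relays.  Say that a relay `t` TOUCHES the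
block DIRECTLY if `t` is joined to some `s ∈ S` by an open path all of whose other vertices lie outside `A`
(`⋃_{s∈S} openConnIn (insert t Aᶜ) t s`) — in the language of the signed-configuration form of the block kernel
(`…KernelCornerForm.lean`), `t` belongs to the relay interface `T` of the block's non-relay cluster.  Let
`Q = {a₀ ↮ S} ∩ {the pairs inside S are open} ∩ ⋂_{t ∈ T₀} {t touches S directly}`.

* `coneComparison`:  `μ({a₀ ↔ b} ∩ Q) ≤ μ({S ↔ b} ∩ Q)`.
  In kernel terms: the BAD configurations (`a₀ ↔ b`, block misses `a₀`, block swallows relays) whose interface contains `T₀` are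
  dominated by the GOOD configurations (`S ↔ b`, block misses `a₀`) whose interface contains `T₀` — for every up-set `{T ⊇ T₀}` of
  interfaces through a fixed relay `a` above `a₀`.  Summed over the non-relay pocket this is the cross-pocket compensation of the
  Lemma-5 gaps `τ'(T) − τ'(a₀)` at a fixed exit relay (numerically the only sign-definite grouping of the leaf expansion found by the
  peel cell, seat e924426c).  The clique condition makes `Q` a mixed-monotone function of the pair of open edge clusters
  `(C_a, C_{a₀})` (every direct contact path and every pair of `S` lies in `C_a`), so the statement is Kozma–Nitzan's Lemma 3 in the
  landed mixed form `knLemma3Mixed` (van den Berg–Häggström–Kahn two-cluster association); under the glued weighting `u/S` the clique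
  condition is almost sure, and for a point block it is vacuous (`coneComparison_point`).
* `coneComparison_pathIn_transfer`: the path-transfer lemma (an open path from a vertex of `C_a(ω)` survives in any `ω' ⊇ C_a(ω)`).
[cite: KozmaNitzan2024, Lemma 3 (pp. 6–7), Lemma 5 (p. 13)] [cite: VandenbergHaggstromKahn2005, Thm. 1.5]
-/

namespace Summit.CriticalPhenomena.PercolationContinuityZ3.Theorems

open MeasureTheory Set
open Literature.Probability.LatticeModels (prodBernoulli)
open Literature.Probability.Percolation (BondConfig openConn openConnIn openGraph openCluster openEdgeCluster PathIn
  reachable_iff_exists_mem_openEdgeCluster openEdgeCluster_subset mem_openEdgeCluster_iff openGraph_adj)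
open scoped BigOperators Classical

noncomputable section

section ConeComparison

open Literature.Probability.LatticeModels Literature.Probability.Percolation

variable {n : ℕ}

/-- An open edge both of whose endpoints are joined to `a` lies in the open edge cluster `C_a`. [folklore] -/
theorem coneComparison_mk_mem_openEdgeCluster {ω : BondConfig (Fin n)} {a x y : Fin n}
    (hadj : (openGraph ω).Adj x y) (hx : (openGraph ω).Reachable a x) :
    s(x, y) ∈ openEdgeCluster ω a := by
  have hadj' := (openGraph_adj ω x y).1 hadj
  refine (mem_openEdgeCluster_iff ω a s(x, y)).2 ⟨hadj'.1, ?_, ?_⟩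
  · rw [Sym2.mk_isDiag_iff]; exact hadj'.2
  · intro v hv
    rcases Sym2.mem_iff.1 hv with rfl | rfl
    · exact hx
    · exact hx.trans hadj.reachable

/-- **Path transfer.**  If `t` is joined to `a` in `ω` and `C_a(ω) ⊆ ω'`, every open path of `ω` from `t` inside a vertex set `V`
is an open path of `ω'` inside `V`. [folklore] -/
theorem coneComparison_pathIn_transfer {ω ω' : BondConfig (Fin n)} {a t s : Fin n} {V : Set (Fin n)}
    (hat : (openGraph ω).Reachable a t) (hsub : openEdgeCluster ω a ⊆ ω') (hp : PathIn (openGraph ω) V t s) :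
    PathIn (openGraph ω') V t s := by
  have key : (openGraph ω).Reachable a s ∧ PathIn (openGraph ω') V t s := by
    refine DCT16.pathIn_induction (fun v => (openGraph ω).Reachable a v ∧ PathIn (openGraph ω') V t v) hp
      ⟨hat, PathIn.refl hp.left_mem⟩ ?_
    rintro x y _ hyV ⟨hax, hpx⟩ hadj
    refine ⟨hax.trans hadj.reachable, hpx.tail ?_ hyV⟩
    have he : s(x, y) ∈ ω' := hsub (coneComparison_mk_mem_openEdgeCluster hadj hax)
    exact (openGraph_adj ω' x y).2 ⟨he, ((openGraph_adj ω x y).1 hadj).2⟩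
  exact key.2

/-- **EXIT-RELAY CONE COMPARISON** (Kozma–Nitzan Lemma 3, mixed form, at the event "the block misses `a₀`, is an open clique, and is
touched directly by every relay of `T₀`").  For `a ∈ T₀` with `μ(a₀ ↔ b) ≤ μ(a ↔ b)`:
`μ({a₀ ↔ b} ∩ Q) ≤ μ({S ↔ b} ∩ Q)`.  See the module docstring.
[cite: KozmaNitzan2024, Lemma 3 (pp. 6–7)] [cite: VandenbergHaggstromKahn2005, Thm. 1.5] -/
theorem coneComparison (u : Sym2 (Fin n) → unitInterval) (A S T₀ : Finset (Fin n)) (b a₀ a : Fin n) (ha : a ∈ T₀)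
    (hle : (prodBernoulli u).real (openConn a₀ b) ≤ (prodBernoulli u).real (openConn a b)) :
    (prodBernoulli u).real (openConn a₀ b ∩
        {ω : BondConfig (Fin n) | (∀ s ∈ S, ¬ (openGraph ω).Reachable a₀ s) ∧
          (∀ s ∈ S, ∀ s' ∈ S, s ≠ s' → s(s, s') ∈ ω) ∧
          ∀ t ∈ T₀, ∃ s ∈ S, ω ∈ openConnIn (insert t ((↑A : Set (Fin n))ᶜ)) t s}) ≤
      (prodBernoulli u).real ((⋃ s ∈ S, openConn s b) ∩
        {ω : BondConfig (Fin n) | (∀ s ∈ S, ¬ (openGraph ω).Reachable a₀ s) ∧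
          (∀ s ∈ S, ∀ s' ∈ S, s ≠ s' → s(s, s') ∈ ω) ∧
          ∀ t ∈ T₀, ∃ s ∈ S, ω ∈ openConnIn (insert t ((↑A : Set (Fin n))ᶜ)) t s}) := by
  set Q : Set (BondConfig (Fin n)) :=
    {ω | (∀ s ∈ S, ¬ (openGraph ω).Reachable a₀ s) ∧ (∀ s ∈ S, ∀ s' ∈ S, s ≠ s' → s(s, s') ∈ ω) ∧
      ∀ t ∈ T₀, ∃ s ∈ S, ω ∈ openConnIn (insert t ((↑A : Set (Fin n))ᶜ)) t s} with hQdef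
  -- on `Q`, the relay `a` reaches every vertex of the block
  have hreach : ∀ ω ∈ Q, ∀ s ∈ S, (openGraph ω).Reachable a s := by
    rintro ω ⟨-, hcl, hT⟩ s hs
    obtain ⟨s₁, hs₁, hpath⟩ := hT a ha
    have has₁ : (openGraph ω).Reachable a s₁ := DCT16.reachable_of_pathIn (DCT16.pathIn_of_mem_openConnIn hpath)
    rcases eq_or_ne s₁ s with rfl | hne
    · exact has₁
    · exact has₁.trans (SimpleGraph.Adj.reachable ((openGraph_adj ω s₁ s).2 ⟨hcl s₁ hs₁ s hs hne, hne⟩))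
  -- `Q` is mixed-monotone in `(C_a, C_{a₀})`
  have hQ : ∀ ω ω' : BondConfig (Fin n), ω ∈ Q → openEdgeCluster ω a ⊆ openEdgeCluster ω' a →
      openEdgeCluster ω' a₀ ⊆ openEdgeCluster ω a₀ → ω' ∈ Q := by
    intro ω ω' hω h2 h1
    have hsub : openEdgeCluster ω a ⊆ ω' := h2.trans (openEdgeCluster_subset ω' a)
    obtain ⟨hno, hcl, hT⟩ := hω
    refine ⟨fun s hs hz => hno s hs ?_, fun s hs s' hs' hne => ?_, fun t ht => ?_⟩
    · rcases (reachable_iff_exists_mem_openEdgeCluster ω' a₀ s).1 hz with rfl | ⟨e, he, hse⟩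
      · exact SimpleGraph.Reachable.refl _
      · exact (reachable_iff_exists_mem_openEdgeCluster ω a₀ _).2 (Or.inr ⟨e, h1 he, hse⟩)
    · have hadj : (openGraph ω).Adj s s' := (openGraph_adj ω s s').2 ⟨hcl s hs s' hs' hne, hne⟩
      exact hsub (coneComparison_mk_mem_openEdgeCluster hadj (hreach ω ⟨hno, hcl, hT⟩ s hs))
    · obtain ⟨s, hs, hpath⟩ := hT t ht
      have hp := DCT16.pathIn_of_mem_openConnIn hpath
      have hat : (openGraph ω).Reachable a t :=
        (hreach ω ⟨hno, hcl, hT⟩ s hs).trans (DCT16.reachable_of_pathIn hp).symm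
      exact ⟨s, hs, DCT16.mem_openConnIn_of_pathIn (coneComparison_pathIn_transfer hat hsub hp)⟩
  have h3 := knLemma3Mixed n u a₀ a b Q 0 hQ le_rfl (by rw [add_zero]; exact hle)
  rw [add_zero] at h3
  refine h3.trans (measureReal_mono ?_ (measure_ne_top _ _))
  rintro ω ⟨hab, hωQ⟩
  obtain ⟨s, hs, -⟩ := hωQ.2.2 a ha
  exact ⟨Set.mem_iUnion₂.2 ⟨s, hs, ((hreach ω hωQ s hs).symm.trans hab : (openGraph ω).Reachable s b)⟩, hωQ⟩

/-- **Point-block form** (no clique condition): for an observer `o`, relays `T₀ ∋ a` each touching `o` directly (an open path to `o`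
avoiding the other relays), and `μ(a₀ ↔ b) ≤ μ(a ↔ b)`:
`μ(a₀ ↔ b, a₀ ↮ o, T₀ touches o) ≤ μ(o ↔ b, a₀ ↮ o, T₀ touches o)`.
[cite: KozmaNitzan2024, Lemma 3 (pp. 6–7), Question 9 (p. 36)] [cite: VandenbergHaggstromKahn2005, Thm. 1.5] -/
theorem coneComparison_point (u : Sym2 (Fin n) → unitInterval) (A T₀ : Finset (Fin n)) (b a₀ a o : Fin n) (ha : a ∈ T₀)
    (hle : (prodBernoulli u).real (openConn a₀ b) ≤ (prodBernoulli u).real (openConn a b)) :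
    (prodBernoulli u).real (openConn a₀ b ∩ ((openConn a₀ o)ᶜ ∩
        {ω : BondConfig (Fin n) | ∀ t ∈ T₀, ω ∈ openConnIn (insert t ((↑A : Set (Fin n))ᶜ)) t o})) ≤
      (prodBernoulli u).real (openConn o b ∩ ((openConn a₀ o)ᶜ ∩
        {ω : BondConfig (Fin n) | ∀ t ∈ T₀, ω ∈ openConnIn (insert t ((↑A : Set (Fin n))ᶜ)) t o})) := by
  have h := coneComparison u A {o} T₀ b a₀ a ha hle
  have e : {ω : BondConfig (Fin n) | (∀ s ∈ ({o} : Finset (Fin n)), ¬ (openGraph ω).Reachable a₀ s) ∧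
        (∀ s ∈ ({o} : Finset (Fin n)), ∀ s' ∈ ({o} : Finset (Fin n)), s ≠ s' → s(s, s') ∈ ω) ∧
        ∀ t ∈ T₀, ∃ s ∈ ({o} : Finset (Fin n)), ω ∈ openConnIn (insert t ((↑A : Set (Fin n))ᶜ)) t s} =
      (openConn a₀ o)ᶜ ∩ {ω : BondConfig (Fin n) | ∀ t ∈ T₀, ω ∈ openConnIn (insert t ((↑A : Set (Fin n))ᶜ)) t o} := by
    ext ω
    simp only [Finset.mem_singleton, forall_eq, exists_eq_left, Set.mem_setOf_eq, Set.mem_inter_iff, Set.mem_compl_iff,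
      ne_eq, not_true_eq_false, IsEmpty.forall_iff, true_and]
    rfl
  have e2 : (⋃ s ∈ ({o} : Finset (Fin n)), (openConn s b : Set (BondConfig (Fin n)))) = openConn o b :=
    Finset.set_biUnion_singleton o _
  rw [e, e2] at h
  exact h

/-- Registered stub `stub_coneComparison_pd` (peel cell (d)): `coneComparison`, ∀-closed.
[cite: KozmaNitzan2024, Lemma 3 (pp. 6–7)] [cite: VandenbergHaggstromKahn2005, Thm. 1.5] -/
theorem stub_coneComparison_pd : ∀ (n : ℕ) (u : Sym2 (Fin n) → unitInterval) (A S T₀ : Finset (Fin n)) (b a₀ a : Fin n), a ∈ T₀ → (prodBernoulli u).real (openConn a₀ b) ≤ (prodBernoulli u).real (openConn a b) → (prodBernoulli u).real (openConn a₀ b ∩ {ω : BondConfig (Fin n) | (∀ s ∈ S, ¬ (openGraph ω).Reachable a₀ s) ∧ (∀ s ∈ S, ∀ s' ∈ S, s ≠ s' → s(s, s') ∈ ω) ∧ ∀ t ∈ T₀, ∃ s ∈ S, ω ∈ openConnIn (insert t ((↑A : Set (Fin n))ᶜ)) t s}) ≤ (prodBernoulli u).real ((⋃ s ∈ S, openConn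 s b) ∩ {ω : BondConfig (Fin n) | (∀ s ∈ S, ¬ (openGraph ω).Reachable a₀ s) ∧ (∀ s ∈ S, ∀ s' ∈ S, s ≠ s' → s(s, s') ∈ ω) ∧ ∀ t ∈ T₀, ∃ s ∈ S, ω ∈ openConnIn (insert t ((↑A : Set (Fin n))ᶜ)) t s}) :=
  fun _ u A S T₀ b a₀ a ha hle => coneComparison u A S T₀ b a₀ a ha hle

end ConeComparison

end

end Summit.CriticalPhenomena.PercolationContinuityZ3.Theorems
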